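import Literature.MathematicalPhysics.QuantumFieldTheory.Balaban1983to89.B6ProjR212TorusBridge
import Literature.MathematicalPhysics.QuantumFieldTheory.Balaban1983to89.B6SectAVectorModelV1
import Literature.MathematicalPhysics.QuantumFieldTheory.Balaban1983to89.B5RealFields
import Literature.MathematicalPhysics.QuantumFieldTheory.BalabanImbrieJaffe1984to88.BIJ85Ineq722DeltaA

/-!
# `Balaban1983to89.B6GOneLevelV1Bridge` — T. Bałaban, *Propagators and renormalization transformations for lattice gauge theories. II*,
# Commun. Math. Phys. **96** (1984) 223–250 [Balaban1984PropagatorsII], (2.19)/(2.22) p. 226 at ONE LEVEL (and (2.90) p. 239 at `Λ′ = ∅`):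
# p21's concrete V1 operator `Δ_a = ∂*∂ + ∂R∂* + Q*aQ` / `G = Δ_a⁻¹` (`B6SectAVectorModelV1.deltaAE`/`GE`) IS the B5 owner's typed
# [Balaban1984PropagatorsI] (1.69)–(1.71) operator `Δ_a = Δ − ∂P∂* + aQ*Q` / `G_k = Δ_a⁻¹` (`B5DeltaA169.DeltaA`, p09's kernel `BIJ85Ineq722DeltaA.Gk`)
# — the ONE-LEVEL OPERATOR BRIDGE, with the weight dictionary `w = a·(L^j)^d`

statement-level skeleton of published theorems with citation tags; proofs where landed; nothing here is a claim about the Yang–Mills mass gap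

PDF held: `paper:balaban1984-cmp96-propagators-rt-ii` (journal page = PDF page + 222; p. 226 [PDF 4], p. 239 [PDF 17]) and
`paper:balaban1984-cmp95-propagators-rt-i` ([B5]; journal page = PDF page + 16; pp. 29–30 [PDF 13–14]).

PRINT (verbatim).  [B6] p. 226: *"½⟨A, Δ_aA⟩ … Δ_a = ∂*∂ + ∂R∂* + Q*aQ (2.19) … a multiplication operator … hence the first equation implies
A = G∂Rλ + GQ*ω, (2.22) where G = Δ_a⁻¹"*; p. 224: *"we admit the case when some domains Ω_j are equal to T_η"*; p. 239: *"On this torus we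
define operators R, Δ_a as in (2.17), (2.19), but only two scales are present now … G_□ = (Δ − ∂P_□∂* + Q*aQ)⁻¹. (2.90)"*.  [B5] pp. 29–30:
*"⟨A, Δ_aA⟩ = ⟨A, ∂*∂A⟩ + ⟨A, ∂R∂*A⟩ + a⟨A, Q*QA⟩ = ⟨A, ΔA⟩ − ⟨A, ∂P∂*A⟩ + a⟨A, Q*QA⟩, (1.69) Δ = ∂*∂ + ∂∂*, R = I − P … We will obtain
an explicit representation of Δ_a⁻¹ = G_k, or simply G. (1.71)"*; p. 21 (1.21): the scalar products on `T_η` carry the weight `η^d`, so that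
`Q* = η^{−d}Qᵀ` (`B5DeltaA169.QvAdj = n^d·(QvOp)ᴴ`).

CITATION HEADER (lean-in-tree rule) — WHAT IS REPRODUCED.  Phase-2 file of the `lit-balaban` typed skeleton (HOME `run/shared/lean/pub/lit-balaban/`),
seat **r03 gen 10** (B6 fold owner; own lane, TAKING 2026-08-21T22:05Z), file (B) of the programme «one-level OPERATOR bridge V1 `G = GE` ↔ [B5]
`Δ_a⁻¹`» towards row **B6.Prop2.5**; rows touched (cells only): **B6.Eq2.19**, **B6.Eq2.22** (p21's decls of record `B6SectAVectorModelV1.deltaAE`/`GE`,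
untouched) as the one-level case of **B5.Eq1.69**/**B5.Eq1.71** (r02's `B5DeltaA169.DeltaA`, p09's `BIJ85Ineq722DeltaA.Gk`, untouched).  Inputs BY
NAME: file (A) `B6ProjR212TorusBridge.RE_bridge` (the `R`-piece), p16's transports `B5Eq117TorusCarriers.tV`/`tS`/`EK` with the dictionaries
`Qk_tV`, `actionS_tV`, `B5Eq147TorusBridge.Dv_tV`, p21's `B5TowerOneStroke.cplx_Qk`/`actionS_trC`/`actionS_eq_mul_cEnergy`, p16's
`B5HkOpLandauMin.divS_towerE`, r02's `B5DeltaA169.DeltaA_eq_curl`/`QvAdj_adjoint`/`solution_eq`/`calG_eq_DeltaA_inv`, p21's `B5Identities197Torus.RT`,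
`B5Hk163RDiv.DstarD`/`form_DstarD`, `B5Hk164Transl.cEnergy_eq`, p21's reality toolkit `B5RealFields` (`isReal_DeltaA`, `IsReal.cplx_mulVec`,
`star_cplx_dotProduct`).  New definitions (with bodies, bookkeeping only): the composite transports `TV`/`TS` (V1 → r02's torus: p16's `tV`/`tS`
followed by p21's `trC (towerE) ∘ cplx` / `trS (towerE) ∘ cplxS`) and the inverse reindexing `TVinv`; no `def … : Prop`.

WHAT IS PROVED (kernel-checked, 0 sorry, standard axioms; every `d ≥ 1`, odd `L > 1` of `Params`, `j ≤ m + K`, `n = L^j`, `M = Mk P j`).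
* §1 the transports and their dictionaries: `TV_apply`, `TV_apply_EK`, `TS_apply`, `star_TV_dotProduct_TV` (ℓ² pairings agree), `divS_TV` (`∂*`),
  `QvOp_TV` (`Q_j`, through p21's one-stroke `cplx_Qk` and p16's `Qk_tV`), `TV_TVinv`.
* §2 the three quadratic-form identities for a domain structure `D : Domains P` with `N(Q′_D) = N(Q′_j)` (`hD`) and a weight `w` whose
  `Q`-form is `a·n^d·Σ_b (Q_jA′)(b)(Q_jA)(b)` (`hQ`): `form_DstarD` (`⟨∂A,∂A⟩`: `⟪dcE A, dcE A⟫ = Ã†(Δ − ∂∂*)Ã`), `form_R` (`⟪∂*A′, R∂*A⟫ =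
  Ã′†∂·RT·∂ᴴÃ`, by file (A)), `form_Q` (`⟪QA′, aQA⟫_w = a·Ã′†Q*QÃ` — THE WEIGHT DICTIONARY: p21's `Q*` is the unweighted ℓ² adjoint `Qᵀ`, the
  print's is `η^{−d}Qᵀ`, so `w = a·n^d`), `DeltaA_eq_DstarD_RT` (`Δ_a = (Δ − ∂∂*) + ∂RT∂ᴴ + aQ*Q` as matrices), **`form_deltaAE`** (polarised:
  `⟪A′, Δ_a^{V1}A⟫ = Ã′†·Δ_a^{[B5]}·Ã` for all real `A′, A`).
* §3 **`TV_deltaAE`**: `(Δ_a^{V1}A)~ = Δ_a^{[B5]}·Ã` (reality of `Δ_a^{[B5]}`, `B5RealFields.isReal_DeltaA`); **`TV_GE`**: `(G^{V1}x)~ = (Δ_a^{[B5]})⁻¹·x̃`;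
  **`GE_apply_eq_sum_Gk`**: `(G^{V1}x)(b) = Σ_{b′} Gk (b) (b′) x(b′)` — p21's `GE` IS p09's kernel `Gk = Re Δ_a⁻¹` of [B5] (1.71).
* §4 the one-level member of Sect. C, p22's `twoScale j hj ∅` ((2.90) at `Λ′ = ∅`): `bondIdx_twoScale_empty_level`, `sum_bondIdx_twoScale_empty`,
  `hQ_twoScale_empty` (any weight constant `a·n^d` on the level-`j` bonds), **`GE_twoScale_empty_apply_eq_sum_Gk`**.
HONEST SCOPE.  One level (`Ω_i = T_η` for all `i`; the multi-level `Δ_a` of (2.19) has no [B5] counterpart); real fields, `U = 1`; the identification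
is exact and PARAMETRIC: V1 lattice factor `c = L^j`, V1 weight `a·(L^j)^d` on the level-`j` constraints ↔ [B5]'s `a` — a bookkeeping consequence of
p21's unweighted ℓ² pairings versus the print's `η^d`-weighted ones ((1.21)), recorded, not a discrepancy of either file with the print.  Value = the
junction that lets every V1 theorem about `G` (p21/p22's Sect. A/C lineage) meet [B5] Prop. 1.2 (row B5.Prop1.2, proved on these tori); NOT summit progress.
-/

noncomputable section

open scoped BigOperators InnerProductSpace Matrix ComplexConjugate

namespace Literature.MathematicalPhysics.QuantumFieldTheory.Balaban1983to89.B6GOneLevelV1Bridge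

open LatticeFieldCalculus B6SectADomainsV1 B6SectAOperatorsV1 B6SectAVectorModelV1 B6SectCTwoScaleV1 B6ProjR212TorusBridge
open B5SectBStatements (Fld Scl cplx cplxS towerM Qk Qsk)
open B5Eq147Landau (Dv)
open B5TowerOneStroke (towerE towerE_eq towerM_eq_fine trC trS trC_apply' trS_apply' cplx_Qk actionS_trC
  actionS_eq_mul_cEnergy)
open B5HkOpLandauMin (divS_towerE star_trS_dotProduct_trS star_cplxS_dotProduct_cplxS)
open B5Eq117TorusCarriers (Mk eK EK eBondK tV tV_apply tS tS_apply tB tB_apply Qk_tV actionS_tV eBondK_symm_apply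
  eK_symm_towerE_symm)
open B5Eq147TorusBridge (Dv_tV inner_tS)
open B5Prop11Plancherel (Tor fine)
open B5Block118 (QvOp)
open B5Action121 (LapS GradOp divS actionS GradOp_conjTranspose_mulVec_eq)
open B5Value126 (PcT)
open B5DeltaA169 (QvAdj DeltaA QvAdj_adjoint DeltaA_isHermitian solution_eq calG_eq_DeltaA_inv)
open B5Identities197Torus (RT RT_mul_GradOp_adjoint)
open B5Hk163RDiv (DstarD form_DstarD)
open B5Hk164Transl (cEnergy cEnergy_eq)
open B5RealFields (IsReal reM isReal_DeltaA isReal_DeltaA_inv star_cplx_dotProduct reM_transpose_of_isHermitian)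
open BalabanImbrieJaffe1984to88.BIJ85AxialPropagator411 (BondSpace PlaqSpace)
open BalabanImbrieJaffe1984to88.BIJ85Ineq722DeltaA (Gk)
open Matrix

variable {P : Params} {j : ℕ} (hj : j ≤ P.m + P.K)

/-! ## §1  The composite transports V1 → r02's typed torus `Tor (fine (L^j) (Mk P j))` and their dictionaries -/

/-- **`Ã`**: a V1 vector field `A ∈ ℓ²(bonds of T^{(0)})` read as a complex vector function on r02's torus `T_η = Tor (fine (L^j) (Mk P j))`
(p16's `tV` followed by p21's one-stroke reindexing `trC (towerE)` and complexification). [cite: Balaban1984PropagatorsI, (1.1) p.18, (1.18) p.20] -/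
def TV (x : BondSpace P) : Tor (fine (P.L ^ j) (Mk P j)) × Fin P.d → ℂ :=
  trC (towerE P.L (Mk P j) j) (cplx (tV hj (WithLp.ofLp x)))

/-- **`λ̃`**: a V1 scalar function read on r02's torus (p16's `tS`, then `trS (towerE) ∘ cplxS`). [cite: Balaban1984PropagatorsI, (1.4) p.18, (1.20) p.20] -/
def TS (f : ScalarSpace P) : Tor (fine (P.L ^ j) (Mk P j)) → ℂ :=
  trS (towerE P.L (Mk P j) j) (cplxS (tS hj (WithLp.ofLp f)))

/-- the inverse reindexing of a REAL vector function on r02's torus to a V1 vector field. [cite: Balaban1984PropagatorsI, (1.1) p.18] -/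
def TVinv (r : Tor (fine (P.L ^ j) (Mk P j)) × Fin P.d → ℝ) : BondSpace P :=
  WithLp.toLp 2 fun b => r (EK hj b.src, b.dir)

/-- values of `Ã`: `Ã(z, μ) = A(⟨EK⁻¹z, μ⟩)`. [cite: Balaban1984PropagatorsI, (1.18) p.20] -/
theorem TV_apply (x : BondSpace P) (z : Tor (fine (P.L ^ j) (Mk P j))) (μ : Fin P.d) :
    TV hj x (z, μ) = ((x ⟨(EK hj).symm z, μ⟩ : ℝ) : ℂ) := by
  simp only [TV, trC_apply', cplx, tV_apply, eBondK_symm_apply, eK_symm_towerE_symm]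

/-- `Ã` at the image of a bond: `Ã(EK b₋, μ(b)) = A(b)`. [cite: Balaban1984PropagatorsI, (1.18) p.20] -/
theorem TV_apply_EK (x : BondSpace P) (b : PBond P 0) : TV hj x (EK hj b.src, b.dir) = ((x b : ℝ) : ℂ) := by
  rw [TV_apply, Equiv.symm_apply_apply]

/-- values of `λ̃`. [cite: Balaban1984PropagatorsI, (1.20) p.20] -/
theorem TS_apply (f : ScalarSpace P) (z : Tor (fine (P.L ^ j) (Mk P j))) :
    TS hj f z = ((f ((EK hj).symm z) : ℝ) : ℂ) := by
  simp only [TS, trS_apply', cplxS, tS_apply, eK_symm_towerE_symm]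

/-- `Ã` is the complexification of a real vector (for p21's reality toolkit). [cite: Balaban1984PropagatorsI, (1.1) p.18] -/
theorem TV_eq_cplx (x : BondSpace P) :
    TV hj x = B5RealFields.cplx (fun i : Tor (fine (P.L ^ j) (Mk P j)) × Fin P.d => x ⟨(EK hj).symm i.1, i.2⟩) := by
  funext ⟨z, μ⟩
  rw [TV_apply]
  rfl

/-- `TVinv` inverts `TV` on real vectors. [cite: Balaban1984PropagatorsI, (1.1) p.18] -/
theorem TV_TVinv (r : Tor (fine (P.L ^ j) (Mk P j)) × Fin P.d → ℝ) : TV hj (TVinv hj r) = B5RealFields.cplx r := by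
  funext ⟨z, μ⟩
  rw [TV_apply, TVinv]
  simp only [Equiv.apply_symm_apply]
  rfl

/-- `Ã` is additive. [cite: Balaban1984PropagatorsI, (1.1) p.18] -/
theorem TV_add (x y : BondSpace P) : TV hj (x + y) = TV hj x + TV hj y := by
  funext ⟨z, μ⟩
  simp only [TV_apply, Pi.add_apply, PiLp.add_apply, Complex.ofReal_add]

/-- the bond reindexing `PBond P 0 ≃ Tor (fine (L^j) (Mk P j)) × Fin d` along `EK`. [cite: Balaban1984PropagatorsI, (1.18) p.20] -/
def bondEK : PBond P 0 ≃ Tor (fine (P.L ^ j) (Mk P j)) × Fin P.d :=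
  (LatticeFieldCalculus.bondEquiv (P := P) (j := 0)).symm.trans ((EK hj).prodCongr (Equiv.refl _))

/-- `bondEK b = (EK b₋, μ(b))`. [cite: Balaban1984PropagatorsI, (1.18) p.20] -/
@[simp] theorem bondEK_apply (b : PBond P 0) : bondEK hj b = (EK hj b.src, b.dir) := rfl

/-- a real dot product on r02's torus is the V1 ℓ² pairing: `Σ_i x(EK⁻¹i) y(EK⁻¹i) = ⟪x, y⟫`. [cite: Balaban1984PropagatorsII, (2.18) p.226] -/
theorem dotProduct_reindex (x y : BondSpace P) :
    (fun i : Tor (fine (P.L ^ j) (Mk P j)) × Fin P.d => x ⟨(EK hj).symm i.1, i.2⟩) ⬝ᵥ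
      (fun i => y ⟨(EK hj).symm i.1, i.2⟩) = ⟪x, y⟫_ℝ := by
  rw [inner_eq_sum, dotProduct]
  rw [← Equiv.sum_comp (bondEK hj)]
  refine Finset.sum_congr rfl fun b _ => ?_
  simp only [bondEK_apply, Equiv.symm_apply_apply]

/-- **the ℓ² pairings agree**: `Ã′†·B̃ = ⟪A′, B⟫`. [cite: Balaban1984PropagatorsII, (2.18) p.226] -/
theorem star_TV_dotProduct_TV (x y : BondSpace P) : star (TV hj x) ⬝ᵥ TV hj y = ((⟪x, y⟫_ℝ : ℝ) : ℂ) := by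
  rw [TV_eq_cplx, TV_eq_cplx, star_cplx_dotProduct, dotProduct_reindex]

/-- **`∂*` = `∂*`**: r02's divergence of `Ã` (lattice factor `η⁻¹ = L^j`) is the transported V1 divergence `∂*A` of p21's `dsE`.
[cite: Balaban1984PropagatorsI, (1.21) p.21] -/
theorem divS_TV (x : BondSpace P) :
    divS (fine (P.L ^ j) (Mk P j)) ((P.L ^ j : ℕ) : ℂ) (TV hj x) = TS hj (dsE ((P.L : ℝ) ^ j) x) := by
  rw [TV, divS_towerE, Dv_tV]
  rfl

/-- the scalar pairings agree: `λ̃′†·λ̃ = ⟪λ′, λ⟫`. [cite: Balaban1984PropagatorsII, (2.8) p.224] -/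
theorem star_TS_dotProduct_TS (f g : ScalarSpace P) : star (TS hj f) ⬝ᵥ TS hj g = ((⟪f, g⟫_ℝ : ℝ) : ℂ) := by
  rw [TS, TS, star_trS_dotProduct_trS, star_cplxS_dotProduct_cplxS, inner_tS_ofLp]

/-- **`Q_j` = `Q_j`**: r02's one-stroke block average `QvOp` of `Ã` is the complexified V1 iterated average `bondAvgIter j A` (p21's `cplx_Qk` with
p16's `Qk_tV`). [cite: Balaban1984PropagatorsI, (1.18) p.20] -/
theorem QvOp_TV (x : BondSpace P) :
    QvOp (P.L ^ j) (Mk P j) *ᵥ TV hj x = cplx (tB (bondAvgIter j (WithLp.ofLp x))) := by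
  rw [TV, ← cplx_Qk, Qk_tV]

/-- the pairing of two complexified coarse fields is the V1 sum over the bonds of `T^{(j)}`. [cite: Balaban1984PropagatorsI, (1.18) p.20] -/
theorem star_cplx_tB_dotProduct (F G : VecField P j ℝ) :
    star (cplx (tB F)) ⬝ᵥ cplx (tB G) = ((∑ b : PBond P j, F b * G b : ℝ) : ℂ) := by
  rw [dotProduct, Complex.ofReal_sum]
  exact Fintype.sum_equiv ⟨fun i => ⟨i.1, i.2⟩, fun b => (b.src, b.dir), fun _ => rfl, fun _ => rfl⟩ _ _
    (fun i => by simp only [Pi.star_apply, cplx, tB_apply, Complex.star_def, Complex.conj_ofReal, Complex.ofReal_mul]; rfl)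

/-! ## §2  The three quadratic forms of (2.19) = (1.69) across the carriers -/

/-- the cast bookkeeping `(L^j : ℕ) = ((L : ℝ)^j : ℝ)` in `ℂ`. [cite: Balaban1984PropagatorsI, (1.18) p.20] -/
theorem natCast_pow_eq : ((P.L ^ j : ℕ) : ℂ) = (((P.L : ℝ) ^ j : ℝ) : ℂ) := by push_cast; ring

/-- **`⟨∂A, ∂A⟩` across the carriers**: the V1 plaquette form `‖∂A‖² = ⟪dcE A, dcE A⟫` is r02's `Ã†(Δ − ∂∂*)Ã` (p21's `DstarD`; (1.21) «⟨∂A,∂A⟩ =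
Σ⟨A_μ,ΔA_μ⟩ − ⟨∂*A,∂*A⟩»), via p16's `actionS_tV`, p21's `actionS_trC`/`actionS_eq_mul_cEnergy`, `cEnergy_eq`, `form_DstarD`.
[cite: Balaban1984PropagatorsI, (1.21) p.21] -/
theorem form_DstarD_TV (x : BondSpace P) :
    star (TV hj x) ⬝ᵥ (DstarD (P.L ^ j) (Mk P j) *ᵥ TV hj x)
      = ((⟪dcE ((P.L : ℝ) ^ j) x, dcE ((P.L : ℝ) ^ j) x⟫_ℝ : ℝ) : ℂ) := by
  rw [form_DstarD, ← cEnergy_eq]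
  congr 1
  -- `cEnergy Ã = 2·actionS_{w=1}(Ã) = 2·curlAction 1 (L^j) A = Σ_p |(∂A)(p)|² = ⟪dcE A, dcE A⟫`
  have h1 : actionS (fine (P.L ^ j) (Mk P j)) ((P.L ^ j : ℕ) : ℂ) 1 (TV hj x)
      = 1 / 2 * cEnergy (P.L ^ j) (Mk P j) (TV hj x) := actionS_eq_mul_cEnergy (Mk P j) (P.L ^ j) 1 (TV hj x)
  have h2 : actionS (fine (P.L ^ j) (Mk P j)) ((P.L ^ j : ℕ) : ℂ) 1 (TV hj x) = curlAction 1 ((P.L : ℝ) ^ j) (WithLp.ofLp x) := by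
    rw [TV, towerE_eq, actionS_trC (towerM_eq_fine P.L (Mk P j) j), natCast_pow_eq, actionS_tV]
  have h3 : ⟪dcE ((P.L : ℝ) ^ j) x, dcE ((P.L : ℝ) ^ j) x⟫_ℝ = 2 * curlAction 1 ((P.L : ℝ) ^ j) (WithLp.ofLp x) := by
    rw [inner_eq_sum, curlAction, Finset.mul_sum, Finset.mul_sum]
    refine Finset.sum_congr rfl fun p _ => ?_
    rw [Real.norm_eq_abs, sq_abs, one_mul]
    show curl _ (WithLp.ofLp x) p * curl _ (WithLp.ofLp x) p = _
    ring
  rw [h3, ← h2, h1]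
  ring

/-- `Δ_a^{[B5]} = (Δ − ∂∂*) + ∂·RT·∂ᴴ + aQ*Q` as matrices: r02's `DeltaA` (typed with `1 − PcT`) rewritten with p21's `DstarD` and the p. 25 projection
`RT` (`RT·∂ᴴ = (1 − PcT)·∂ᴴ`, `B5Identities197Torus.RT_mul_GradOp_adjoint`). [cite: Balaban1984PropagatorsI, (1.69) p.29] -/
theorem DeltaA_eq_DstarD_RT {d : ℕ} (n : ℕ) [NeZero n] (M : Fin d → ℕ) [∀ μ, NeZero (M μ)] (a : ℝ) :
    DeltaA n M a = DstarD n M + GradOp (fine n M) (n : ℂ) * RT n M * (GradOp (fine n M) (n : ℂ))ᴴ + (a : ℂ) • (QvAdj n M * QvOp n M) := by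
  rw [Matrix.mul_assoc (GradOp (fine n M) (n : ℂ)) (RT n M), RT_mul_GradOp_adjoint, ← Matrix.mul_assoc, DeltaA, DstarD,
    Matrix.mul_sub, Matrix.mul_one, Matrix.sub_mul]
  abel

/-- moving a matrix across the Hermitian pairing: `v†(Aw) = (Aᴴv)†w`. [cite: Balaban1984PropagatorsI, (1.21) p.21] -/
theorem star_dotProduct_mulVec {m n : Type*} [Fintype m] [Fintype n] (A : Matrix m n ℂ) (v : m → ℂ) (w : n → ℂ) :
    star v ⬝ᵥ (A *ᵥ w) = star (Aᴴ *ᵥ v) ⬝ᵥ w := by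
  rw [Matrix.dotProduct_mulVec, Matrix.star_mulVec, Matrix.conjTranspose_conjTranspose]

/-- **`⟨∂*A′, R∂*A⟩` across the carriers** (the `R`-piece, file (A)): for `N(Q′_D) = N(Q′_j)`, `Ã′†(∂·RT·∂ᴴ)Ã = ⟪∂*A′, R_D∂*A⟫`, lattice factor
`c = L^j`. [cite: Balaban1984PropagatorsII, (2.12) p.225 + (2.19) p.226] -/
theorem form_R_TV (D : Domains P) (hD : ∀ μ : ScalarSpace P, QpE D μ = 0 ↔ siteAvgIter j (WithLp.ofLp μ) = 0)
    (x' x : BondSpace P) :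
    star (TV hj x') ⬝ᵥ ((GradOp (fine (P.L ^ j) (Mk P j)) ((P.L ^ j : ℕ) : ℂ) * RT (P.L ^ j) (Mk P j) *
        (GradOp (fine (P.L ^ j) (Mk P j)) ((P.L ^ j : ℕ) : ℂ))ᴴ) *ᵥ TV hj x)
      = ((⟪dsE ((P.L : ℝ) ^ j) x', RE D ((P.L : ℝ) ^ j) (dsE ((P.L : ℝ) ^ j) x)⟫_ℝ : ℝ) : ℂ) := by
  have hc : ((P.L : ℝ) ^ j) ≠ 0 := pow_ne_zero _ (Nat.cast_ne_zero.2 P.L_pos.ne')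
  rw [← Matrix.mulVec_mulVec, ← Matrix.mulVec_mulVec, star_dotProduct_mulVec, GradOp_conjTranspose_mulVec_eq,
    GradOp_conjTranspose_mulVec_eq, divS_TV, divS_TV, TS, TS, ← RE_bridge hj D hD hc, star_trS_dotProduct_trS,
    star_cplxS_dotProduct_cplxS, inner_tS_ofLp]

/-- `v†(Q*w) = n^d·(Qv)†w` (r02's `QvAdj_adjoint`, solved for the left-hand side). [cite: Balaban1984PropagatorsI, (1.18) p.20, (1.21) p.21] -/
theorem star_dotProduct_QvAdj_mulVec {d : ℕ} (n : ℕ) [NeZero n] (M : Fin d → ℕ) [∀ μ, NeZero (M μ)]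
    (A : Tor (fine n M) × Fin d → ℂ) (B : Tor M × Fin d → ℂ) :
    star A ⬝ᵥ (QvAdj n M *ᵥ B) = (n : ℂ) ^ d * (star (QvOp n M *ᵥ A) ⬝ᵥ B) := by
  have hn : ((n : ℂ) ^ d) ≠ 0 := pow_ne_zero _ (by exact_mod_cast NeZero.ne n)
  rw [QvAdj_adjoint, ← mul_assoc, mul_inv_cancel₀ hn, one_mul]

/-- **`⟨QA′, aQA⟩` across the carriers — THE WEIGHT DICTIONARY**: `Ã′†(a·Q*Q)Ã = a·n^d·Σ_{b⊂T^{(j)}} (Q_jA′)(b)(Q_jA)(b)`; so p21's unweighted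
V1 term `⟪QA′, wQA⟫ = Σ_b w(Q_jA′)(b)(Q_jA)(b)` matches [B5]'s `a` exactly when `w = a·n^d = a·(L^j)^d` (`Q* = η^{−d}Qᵀ`, (1.21)).
[cite: Balaban1984PropagatorsI, (1.69) p.29, (1.21) p.21] -/
theorem form_Q_TV (a : ℝ) (x' x : BondSpace P) :
    star (TV hj x') ⬝ᵥ ((((a : ℝ) : ℂ) • (QvAdj (P.L ^ j) (Mk P j) * QvOp (P.L ^ j) (Mk P j))) *ᵥ TV hj x)
      = ((a * ((P.L : ℝ) ^ j) ^ P.d *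
          ∑ b : PBond P j, bondAvgIter j (WithLp.ofLp x') b * bondAvgIter j (WithLp.ofLp x) b : ℝ) : ℂ) := by
  rw [Matrix.smul_mulVec, dotProduct_smul, ← Matrix.mulVec_mulVec, star_dotProduct_QvAdj_mulVec, QvOp_TV, QvOp_TV,
    star_cplx_tB_dotProduct, smul_eq_mul]
  push_cast
  ring

/-- **(2.19) = (1.69) as quadratic forms, diagonal**: `Ã†Δ_a^{[B5]}Ã = ⟪A, Δ_a^{V1}A⟫` for every real V1 field `A`, under `hD` (site constraints =
`N(Q′_j)`) and the weight dictionary `hQ`. [cite: Balaban1984PropagatorsII, (2.19) p.226] -/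
theorem form_deltaAE_diag (D : Domains P) (hD : ∀ μ : ScalarSpace P, QpE D μ = 0 ↔ siteAvgIter j (WithLp.ofLp μ) = 0)
    {w : BondIdx D → ℝ} (a : ℝ)
    (hQ : ∀ x' x : BondSpace P, ⟪QE D x', aE D w (QE D x)⟫_ℝ
      = a * ((P.L : ℝ) ^ j) ^ P.d * ∑ b : PBond P j, bondAvgIter j (WithLp.ofLp x') b * bondAvgIter j (WithLp.ofLp x) b)
    (x : BondSpace P) :
    star (TV hj x) ⬝ᵥ (DeltaA (P.L ^ j) (Mk P j) a *ᵥ TV hj x) = ((⟪x, deltaAE D ((P.L : ℝ) ^ j) w x⟫_ℝ : ℝ) : ℂ) := by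
  rw [DeltaA_eq_DstarD_RT, Matrix.add_mulVec, Matrix.add_mulVec, dotProduct_add, dotProduct_add, form_DstarD_TV,
    form_R_TV hj D hD, form_Q_TV, inner_deltaAE_right, hQ]
  push_cast
  ring

/-- the [B5] form is SYMMETRIC on real vectors (`Δ_a^{[B5]}` has real entries and is Hermitian: `B5RealFields.isReal_DeltaA`,
`B5DeltaA169.DeltaA_isHermitian`). [cite: Balaban1984PropagatorsI, (1.69) p.29, Prop. 1.1 p.33] -/
theorem form_DeltaA_symm {a : ℝ} (ha : 0 < a) (x' x : BondSpace P) :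
    star (TV hj x') ⬝ᵥ (DeltaA (P.L ^ j) (Mk P j) a *ᵥ TV hj x) = star (TV hj x) ⬝ᵥ (DeltaA (P.L ^ j) (Mk P j) a *ᵥ TV hj x') := by
  have hn : 1 ≤ P.L ^ j := Nat.one_le_pow _ _ P.L_pos
  have hS : (reM (DeltaA (P.L ^ j) (Mk P j) a))ᵀ = reM (DeltaA (P.L ^ j) (Mk P j) a) :=
    reM_transpose_of_isHermitian (DeltaA_isHermitian (P.L ^ j) hn (Mk P j) a ha)
  rw [TV_eq_cplx, TV_eq_cplx, ← (isReal_DeltaA (P.L ^ j) (Mk P j) a).cplx_mulVec,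
    ← (isReal_DeltaA (P.L ^ j) (Mk P j) a).cplx_mulVec, star_cplx_dotProduct, star_cplx_dotProduct]
  congr 1
  set S := reM (DeltaA (P.L ^ j) (Mk P j) a)
  have hvm : ∀ u' : Tor (fine (P.L ^ j) (Mk P j)) × Fin P.d → ℝ, u' ᵥ* S = S *ᵥ u' := fun u' => by
    rw [← Matrix.vecMul_transpose, hS]
  rw [Matrix.dotProduct_mulVec, hvm, dotProduct_comm]

/-- **(2.19) = (1.69), polarised**: `Ã′†Δ_a^{[B5]}Ã = ⟪A′, Δ_a^{V1}A⟫` for all real V1 fields `A′, A`. [cite: Balaban1984PropagatorsII, (2.19) p.226] -/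
theorem form_deltaAE (D : Domains P) (hD : ∀ μ : ScalarSpace P, QpE D μ = 0 ↔ siteAvgIter j (WithLp.ofLp μ) = 0)
    {w : BondIdx D → ℝ} {a : ℝ} (ha : 0 < a)
    (hQ : ∀ x' x : BondSpace P, ⟪QE D x', aE D w (QE D x)⟫_ℝ
      = a * ((P.L : ℝ) ^ j) ^ P.d * ∑ b : PBond P j, bondAvgIter j (WithLp.ofLp x') b * bondAvgIter j (WithLp.ofLp x) b)
    (x' x : BondSpace P) :
    star (TV hj x') ⬝ᵥ (DeltaA (P.L ^ j) (Mk P j) a *ᵥ TV hj x) = ((⟪x', deltaAE D ((P.L : ℝ) ^ j) w x⟫_ℝ : ℝ) : ℂ) := by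
  -- polarisation of the diagonal identity: both sides are symmetric and biadditive
  set c : ℝ := (P.L : ℝ) ^ j
  set φ : BondSpace P → BondSpace P → ℂ := fun u v => star (TV hj u) ⬝ᵥ (DeltaA (P.L ^ j) (Mk P j) a *ᵥ TV hj v) with hφ
  have φsymm : ∀ u v, φ u v = φ v u := fun u v => form_DeltaA_symm hj ha u v
  have φadd : ∀ u v v', φ u (v + v') = φ u v + φ u v' := fun u v v' => by
    simp only [hφ, TV_add, Matrix.mulVec_add, dotProduct_add]
  have φdiag : ∀ u, φ u u = ((⟪u, deltaAE D c w u⟫_ℝ : ℝ) : ℂ) := fun u => form_deltaAE_diag hj D hD a hQ u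
  have ψsymm : ∀ u v : BondSpace P, ⟪u, deltaAE D c w v⟫_ℝ = ⟪v, deltaAE D c w u⟫_ℝ := fun u v => by
    rw [← inner_deltaAE_left, real_inner_comm]
  -- expand `φ (x'+x) (x'+x)`
  have hsum : φ (x' + x) (x' + x) = φ x' x' + 2 * φ x' x + φ x x := by
    rw [φadd, φsymm (x' + x) x', φsymm (x' + x) x, φadd, φadd, φsymm x x']
    ring
  have hsum' : ((⟪x' + x, deltaAE D c w (x' + x)⟫_ℝ : ℝ) : ℂ)
      = ((⟪x', deltaAE D c w x'⟫_ℝ : ℝ) : ℂ) + 2 * ((⟪x', deltaAE D c w x⟫_ℝ : ℝ) : ℂ) + ((⟪x, deltaAE D c w x⟫_ℝ : ℝ) : ℂ) := by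
    rw [map_add, inner_add_left, inner_add_right, inner_add_right, ψsymm x x']
    push_cast
    ring
  have key : 2 * φ x' x = 2 * ((⟪x', deltaAE D c w x⟫_ℝ : ℝ) : ℂ) := by
    have h := φdiag (x' + x)
    rw [hsum, hsum', φdiag x', φdiag x] at h
    linear_combination h
  have h2 : (2 : ℂ) ≠ 0 := two_ne_zero
  exact mul_left_cancel₀ h2 key

/-! ## §3  The operator identity and `G^{V1} = G_k^{[B5]}` -/

/-- **`(Δ_a^{V1}A)~ = Δ_a^{[B5]}·Ã`** — p21's concrete V1 operator (2.19) IS r02's typed (1.69)/(1.73) operator under the transport (one level,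
`c = L^j`, weight `a·n^d`). [cite: Balaban1984PropagatorsII, (2.19) p.226] -/
theorem TV_deltaAE (D : Domains P) (hD : ∀ μ : ScalarSpace P, QpE D μ = 0 ↔ siteAvgIter j (WithLp.ofLp μ) = 0)
    {w : BondIdx D → ℝ} {a : ℝ} (ha : 0 < a)
    (hQ : ∀ x' x : BondSpace P, ⟪QE D x', aE D w (QE D x)⟫_ℝ
      = a * ((P.L : ℝ) ^ j) ^ P.d * ∑ b : PBond P j, bondAvgIter j (WithLp.ofLp x') b * bondAvgIter j (WithLp.ofLp x) b)
    (x : BondSpace P) :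
    TV hj (deltaAE D ((P.L : ℝ) ^ j) w x) = DeltaA (P.L ^ j) (Mk P j) a *ᵥ TV hj x := by
  -- both sides are complexified real vectors
  set u₁ : Tor (fine (P.L ^ j) (Mk P j)) × Fin P.d → ℝ := fun i => deltaAE D ((P.L : ℝ) ^ j) w x ⟨(EK hj).symm i.1, i.2⟩ with hu₁
  set u₂ : Tor (fine (P.L ^ j) (Mk P j)) × Fin P.d → ℝ := fun i => x ⟨(EK hj).symm i.1, i.2⟩ with hu₂
  set v : Tor (fine (P.L ^ j) (Mk P j)) × Fin P.d → ℝ := reM (DeltaA (P.L ^ j) (Mk P j) a) *ᵥ u₂ with hv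
  have hL : TV hj (deltaAE D ((P.L : ℝ) ^ j) w x) = B5RealFields.cplx u₁ := TV_eq_cplx hj _
  have hR : DeltaA (P.L ^ j) (Mk P j) a *ᵥ TV hj x = B5RealFields.cplx v := by
    rw [TV_eq_cplx, ← (isReal_DeltaA (P.L ^ j) (Mk P j) a).cplx_mulVec]
  -- every real test vector pairs equally with both sides
  have htest : ∀ r : Tor (fine (P.L ^ j) (Mk P j)) × Fin P.d → ℝ, r ⬝ᵥ u₁ = r ⬝ᵥ v := by
    intro r
    have h1 : star (TV hj (TVinv hj r)) ⬝ᵥ TV hj (deltaAE D ((P.L : ℝ) ^ j) w x)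
        = ((⟪TVinv hj r, deltaAE D ((P.L : ℝ) ^ j) w x⟫_ℝ : ℝ) : ℂ) := star_TV_dotProduct_TV hj _ _
    have h2 := form_deltaAE hj D hD ha hQ (TVinv hj r) x
    rw [← h1, hL, hR, TV_TVinv, star_cplx_dotProduct, star_cplx_dotProduct] at h2
    exact_mod_cast h2.symm
  have huv : u₁ = v := by
    have h0 : (u₁ - v) ⬝ᵥ (u₁ - v) = 0 := by
      rw [dotProduct_sub, htest (u₁ - v), sub_self]
    exact sub_eq_zero.1 (dotProduct_self_eq_zero.1 h0)
  rw [hL, hR, huv]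

/-- **`(G^{V1}x)~ = (Δ_a^{[B5]})⁻¹·x̃`**: p21's `G = Δ_a⁻¹` (2.22) of the one-level V1 structure IS [B5]'s `G_k = Δ_a⁻¹` (1.71) under the
transport. [cite: Balaban1984PropagatorsII, (2.22) p.226] -/
theorem TV_GE (D : Domains P) (hD : ∀ μ : ScalarSpace P, QpE D μ = 0 ↔ siteAvgIter j (WithLp.ofLp μ) = 0)
    {w : BondIdx D → ℝ} (hw : ∀ i, 0 < w i) {a : ℝ} (ha : 0 < a)
    (hQ : ∀ x' x : BondSpace P, ⟪QE D x', aE D w (QE D x)⟫_ℝ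
      = a * ((P.L : ℝ) ^ j) ^ P.d * ∑ b : PBond P j, bondAvgIter j (WithLp.ofLp x') b * bondAvgIter j (WithLp.ofLp x) b)
    (x : BondSpace P) :
    TV hj (GE D (c := (P.L : ℝ) ^ j) (pow_ne_zero j (Nat.cast_ne_zero.2 P.L_pos.ne')) hw x) = (DeltaA (P.L ^ j) (Mk P j) a)⁻¹ *ᵥ TV hj x := by
  have hn : 1 ≤ P.L ^ j := Nat.one_le_pow _ _ P.L_pos
  have hc : ((P.L : ℝ) ^ j) ≠ 0 := pow_ne_zero _ (Nat.cast_ne_zero.2 P.L_pos.ne')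
  have hsol : DeltaA (P.L ^ j) (Mk P j) a *ᵥ TV hj (GE D hc hw x) = TV hj x := by
    rw [← TV_deltaAE hj D hD ha hQ]
    congr 1
    exact congrArg (fun T : BondSpace P →ₗ[ℝ] BondSpace P => T x) (deltaAE_comp_GE D hc hw)
  rw [solution_eq (P.L ^ j) hn (Mk P j) a ha hsol, calG_eq_DeltaA_inv]

/-- **p21's `GE` IS p09's kernel `Gk = Re Δ_a⁻¹` of [B5] (1.71)**: `(G^{V1}x)(b) = Σ_{b′} G_k(b, b′)·x(b′)` with
`G_k(b, b′) = Re (Δ_a⁻¹)((EK b₋, μ(b)), (EK b′₋, μ(b′)))` (`BIJ85Ineq722DeltaA.Gk`), one level, weight `a·n^d`.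
[cite: Balaban1984PropagatorsII, (2.22) p.226] -/
theorem GE_apply_eq_sum_Gk (D : Domains P) (hD : ∀ μ : ScalarSpace P, QpE D μ = 0 ↔ siteAvgIter j (WithLp.ofLp μ) = 0)
    {w : BondIdx D → ℝ} (hw : ∀ i, 0 < w i) {a : ℝ} (ha : 0 < a)
    (hQ : ∀ x' x : BondSpace P, ⟪QE D x', aE D w (QE D x)⟫_ℝ
      = a * ((P.L : ℝ) ^ j) ^ P.d * ∑ b : PBond P j, bondAvgIter j (WithLp.ofLp x') b * bondAvgIter j (WithLp.ofLp x) b)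
    (x : BondSpace P) (b : PBond P 0) :
    GE D (c := (P.L : ℝ) ^ j) (pow_ne_zero j (Nat.cast_ne_zero.2 P.L_pos.ne')) hw x b = ∑ b' : PBond P 0, Gk hj a (b.src, b.dir) (b'.src, b'.dir) * x b' := by
  have h := congrArg (fun F => (F (EK hj b.src, b.dir)).re) (TV_GE hj D hD hw ha hQ x)
  simp only [TV_apply_EK, Complex.ofReal_re] at h
  rw [h, Matrix.mulVec, dotProduct, ← Equiv.sum_comp (bondEK hj), Complex.re_sum]
  refine Finset.sum_congr rfl fun b' _ => ?_
  rw [bondEK_apply, TV_apply_EK, Complex.re_mul_ofReal]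
  rfl

/-! ## §4  The one-level member of Sect. C: p22's `twoScale j hj ∅` ((2.90) at `Λ′ = ∅`) -/

section TwoScaleEmpty

variable {j : ℕ} (hj1 : j + 1 ≤ P.m + P.K)

/-- at `Λ′ = ∅` every constrained bond of the two-scale structure sits on level `j` (`Λ_i = ∅` for `i ≠ j`, `Λ_j = T^{(j)}`).
[cite: Balaban1984PropagatorsII, (2.97) p.240] -/
theorem bondIdx_twoScale_empty_level (p : BondIdx (twoScale j hj1 (∅ : Finset (Site P (j + 1))))) : (p.1.1 : ℕ) = j := by
  obtain ⟨⟨⟨i, hi⟩, b⟩, hb⟩ := p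
  show i = j
  by_contra hne
  rcases Nat.lt_or_gt_of_ne hne with hlt | hgt
  · exact twoScale.not_lamBond_of_lt hlt b hb
  · have hik : i ≤ j + 1 := by
      have := hi; simp [twoScale.k_eq] at this; omega
    have hieq : i = j + 1 := by omega
    subst hieq
    have := (twoScale.lamBond_succ (hj := hj1) (Λ' := (∅ : Finset (Site P (j + 1)))) b).1 hb
    simp at this

/-- the level-`j` bonds ARE the constrained bonds of `twoScale j hj ∅`. [cite: Balaban1984PropagatorsII, (2.97) p.240] -/
def bondIdxOfEmpty (b : PBond P j) : BondIdx (twoScale j hj1 (∅ : Finset (Site P (j + 1)))) :=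
  ⟨⟨⟨j, by simp [twoScale.k_eq]⟩, b⟩, (twoScale.lamBond_j b).2 ⟨Finset.notMem_empty _, Finset.notMem_empty _⟩⟩

/-- `bondIdxOfEmpty` is a bijection. [cite: Balaban1984PropagatorsII, (2.97) p.240] -/
theorem bondIdxOfEmpty_bijective : Function.Bijective (bondIdxOfEmpty (P := P) hj1) := by
  constructor
  · intro b b' h
    have := congrArg (fun p : BondIdx (twoScale j hj1 (∅ : Finset (Site P (j + 1)))) => p.1) h
    simp only [bondIdxOfEmpty] at this
    exact eq_of_heq (Sigma.mk.inj this).2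
  · rintro ⟨⟨⟨i, hi⟩, b⟩, hb⟩
    have hij : i = j := bondIdx_twoScale_empty_level hj1 ⟨⟨⟨i, hi⟩, b⟩, hb⟩
    subst hij
    exact ⟨b, rfl⟩

/-- sums over the constrained bonds of `twoScale j hj ∅` are sums over the bonds of `T^{(j)}`. [cite: Balaban1984PropagatorsII, (2.97) p.240] -/
theorem sum_bondIdx_twoScale_empty {α : Type*} [AddCommMonoid α]
    (F : BondIdx (twoScale j hj1 (∅ : Finset (Site P (j + 1)))) → α) :
    ∑ p, F p = ∑ b : PBond P j, F (bondIdxOfEmpty hj1 b) :=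
  (Equiv.sum_comp (Equiv.ofBijective _ (bondIdxOfEmpty_bijective hj1)) F).symm

/-- **the weight dictionary for the one-level member**: with any weight equal to `a·(L^j)^d` on the level-`j` bonds, p21's `Q`-form of
`twoScale j hj ∅` is `a·n^d·Σ_b (Q_jA′)(b)(Q_jA)(b)`. [cite: Balaban1984PropagatorsII, (2.19)–(2.20) p.226 + (2.90) p.239] -/
theorem hQ_twoScale_empty {w : BondIdx (twoScale j hj1 (∅ : Finset (Site P (j + 1)))) → ℝ} {a : ℝ}
    (hwa : ∀ p, w p = a * ((P.L : ℝ) ^ j) ^ P.d) (x' x : BondSpace P) :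
    ⟪QE (twoScale j hj1 ∅) x', aE (twoScale j hj1 ∅) w (QE (twoScale j hj1 ∅) x)⟫_ℝ
      = a * ((P.L : ℝ) ^ j) ^ P.d * ∑ b : PBond P j, bondAvgIter j (WithLp.ofLp x') b * bondAvgIter j (WithLp.ofLp x) b := by
  rw [inner_eq_sum, sum_bondIdx_twoScale_empty hj1, Finset.mul_sum]
  refine Finset.sum_congr rfl fun b _ => ?_
  rw [aE_apply, hwa, QE_apply, QE_apply]
  show bondAvgIter j (WithLp.ofLp x') b * (a * ((P.L : ℝ) ^ j) ^ P.d * bondAvgIter j (WithLp.ofLp x) b) = _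
  ring

/-- **`G_□` of (2.90) at `Λ′ = ∅` IS [B5]'s `G_j = Δ_a⁻¹`**: for the one-level two-scale structure with lattice factor `L^j` and weight `a·(L^j)^d`,
`(G^{V1}x)(b) = Σ_{b′} Gk_j(b, b′) x(b′)`. [cite: Balaban1984PropagatorsII, (2.90) p.239 + (2.22) p.226] -/
theorem GE_twoScale_empty_apply_eq_sum_Gk {w : BondIdx (twoScale j hj1 (∅ : Finset (Site P (j + 1)))) → ℝ} (hw : ∀ i, 0 < w i)
    {a : ℝ} (ha : 0 < a) (hwa : ∀ p, w p = a * ((P.L : ℝ) ^ j) ^ P.d) (x : BondSpace P) (b : PBond P 0) :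
    GE (twoScale j hj1 ∅) (c := (P.L : ℝ) ^ j) (pow_ne_zero j (Nat.cast_ne_zero.2 P.L_pos.ne')) hw x b
      = ∑ b' : PBond P 0, Gk (Nat.le_of_succ_le hj1) a (b.src, b.dir) (b'.src, b'.dir) * x b' :=
  GE_apply_eq_sum_Gk (Nat.le_of_succ_le hj1) (twoScale j hj1 ∅) (QpE_twoScale_empty_eq_zero_iff hj1) hw ha
    (hQ_twoScale_empty hj1 hwa) x b

/-- and as the transported vector: `(G^{V1}x)~ = (Δ_a^{[B5]})⁻¹·x̃`. [cite: Balaban1984PropagatorsII, (2.90) p.239 + (2.22) p.226] -/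
theorem TV_GE_twoScale_empty {w : BondIdx (twoScale j hj1 (∅ : Finset (Site P (j + 1)))) → ℝ} (hw : ∀ i, 0 < w i)
    {a : ℝ} (ha : 0 < a) (hwa : ∀ p, w p = a * ((P.L : ℝ) ^ j) ^ P.d) (x : BondSpace P) :
    TV (Nat.le_of_succ_le hj1) (GE (twoScale j hj1 ∅) (c := (P.L : ℝ) ^ j) (pow_ne_zero j (Nat.cast_ne_zero.2 P.L_pos.ne')) hw x)
      = (DeltaA (P.L ^ j) (Mk P j) a)⁻¹ *ᵥ TV (Nat.le_of_succ_le hj1) x :=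
  TV_GE (Nat.le_of_succ_le hj1) (twoScale j hj1 ∅) (QpE_twoScale_empty_eq_zero_iff hj1) hw ha (hQ_twoScale_empty hj1 hwa) x

end TwoScaleEmpty

end Literature.MathematicalPhysics.QuantumFieldTheory.Balaban1983to89.B6GOneLevelV1Bridge

end
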